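import Literature.NumberTheory.LFunctions.BurnolFourierZetaProofs
import Literature.NumberTheory.LFunctions.BurnolZetaSystems
import HarnessLib

/-!
# The co-Poisson subspace lies in the extended Sonine space: `P_a ⊆ L_a`

LINE 1 — LABEL: RH-FREE (harmonic analysis of `L²` co-Poisson sums; no hypothesis and no
conclusion about zeros of `ζ`). bears_on: B-C/B-P (LADDER-RH COLUMN 6, de Branges framework).
WHAT THIS IS NOT: not a route, not an RH criterion; nothing here bears on the truth of RH.

Burnol [Burnol2004b, §2, TeX l.404–411 and Definition l.493–498] introduces the co-Poisson
subspace `P_a` of `L²` co-Poisson sums `F = Σ_{n≥1} g(t/n)/n − ∫₀^∞ g(u)du/u` of functions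
`g ∈ L¹(a, A)`, `A = 1/a`, and writes `P_a ⊂ L_a`: "its co-Poisson sum is constant on `(0,a)` …
and the cosine transform is constant on `(0, 1/A)`" — by the co-Poisson intertwining formula of
[Burnol2004, Thm 4.2] (as tempered distributions, for `∫|g|dt/t + ∫|g|dt < ∞`). The tree's
`Literature.NumberTheory.LFunctions.coPoissonP` records the definition WITHOUT this inclusion ("that
inclusion is a theorem, not built into this definition", its docstring). This module PROVES it:
`coPoissonP_subset_sonineL : 0 < a → coPoissonP a ⊆ sonineL a` (with the explicit constants,
`coPoissonSum_ae_eq_const`, and the `K_a` case of two vanishing moments,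
`mem_sonineK_of_coPoissonSum`; the pointwise-a.e. `L²` intertwining `fourier_ae_eq_coSumDual` and
the `𝓕₊`-stability `fourier_mem_coPoissonP` of `P_a`; glue `coSum_eq_coPoissonSum_of_even` and the
smooth examples `CoPoisson.IsTestAway.toLp_coSum_mem_coPoissonP`; and `P_a` is a linear subspace:
`zero_mem_coPoissonP`, `smul_mem_coPoissonP`, `add_mem_coPoissonP`, with `P_a = {0}` for `a ≥ 1`,
`coPoissonP_eq_singleton_zero_of_one_le`, and `coPoissonP_antitone`), from
`Burnol2004_thm_4_2_holds` (`BurnolFourierZetaProofs.lean`) and the identification of the `L²`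
Fourier transform with the distributional one (Mathlib `MeasureTheory.Lp.fourier_toTemperedDistribution_eq`).

Proof outline. Given `F ∈ P_a` with datum `g` (integrable on `(a, 1/a)`, zero outside), replace `g`
by a measurable modification `g₂` (still zero outside `(a,1/a)`) and let `gₑ(u) = g₂(|u|)` (even).
Then `F = P'(gₑ)` a.e. (`coSum gₑ`, the scalings `t ↦ t/n` being quasi-measure-preserving);
`P'(gₑ)` is even and equals `−∫₀^∞ g(u)du/u` on `(0,a)`; for every Schwartz `ψ`,
`∫ ψ·𝓕F = ∫ 𝓕ψ·F = ∫ 𝓕ψ·P'(gₑ) = ∫ (dual sum)·ψ` (Thm 4.2), so `𝓕F` is a.e. the dual sum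
`Σ gₑ(n/t)/|t| − ∫₀^∞ gₑ`, which equals `−∫₀^∞ g` on `(0,a)`.

## References
* [Burnol2004b] J.-F. Burnol, *Two complete and minimal systems associated with the zeros of the
  Riemann zeta function*, J. Théor. Nombres Bordeaux 16 (2004) 65–94, §2. [cite: Burnol2004b, §2 (arXiv:math/0203120v7 p. 5, TeX l.404–411, 493–498)]
* [Burnol2004] J.-F. Burnol, *On Fourier and Zeta(s)*, Forum Math. 16 (2004) 789–840, Thm 4.2.
  [cite: Burnol2004, Thm 4.2 (TeX l. 1235)]
-/

noncomputable section

open MeasureTheory Complex Filter Set FourierTransform SchwartzMap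
open scoped Topology ENNReal

namespace Literature.NumberTheory.LFunctions

open CoPoisson

section CoPoissonSubspace

/-- Scalings `t ↦ t·c`, `c ≠ 0`, are quasi-measure-preserving for Lebesgue measure. [folklore] -/
private theorem quasiMeasurePreserving_mul_right {c : ℝ} (hc : c ≠ 0) :
    Measure.QuasiMeasurePreserving (fun t : ℝ ↦ t * c) volume volume := by
  refine ⟨measurable_id.mul_const c, ?_⟩
  rw [Real.map_volume_mul_right hc]
  exact Measure.smul_absolutelyContinuous

/-- A bump Schwartz function equal to `1` on `[-R, R]`. [folklore] -/
private theorem exists_schwartz_eq_one (R : ℝ) (hR : 0 < R) :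
    ∃ ψ : 𝓢(ℝ, ℂ), ∀ x : ℝ, |x| ≤ R → ψ x = 1 := by
  set b : ContDiffBump (0 : ℝ) := ⟨R, R + 1, hR, by linarith⟩ with hb
  have hsmooth : ContDiff ℝ ((⊤ : ℕ∞) : WithTop ℕ∞) (fun x : ℝ ↦ ((b x : ℝ) : ℂ)) :=
    Complex.ofRealCLM.contDiff.comp b.contDiff
  have hsupp : HasCompactSupport (fun x : ℝ ↦ ((b x : ℝ) : ℂ)) :=
    b.hasCompactSupport.comp_left Complex.ofReal_zero
  refine ⟨hsupp.toSchwartzMap hsmooth, fun x hx ↦ ?_⟩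
  show ((b x : ℝ) : ℂ) = 1
  rw [b.one_of_mem_closedBall (by rw [Metric.mem_closedBall, dist_zero_right, Real.norm_eq_abs]; exact hx)]
  simp

/-- `(Iα)(u) = α(1/u)/u` for `u > 0`. [folklore] -/
private theorem inv_apply_of_pos' (α : ℝ → ℂ) {u : ℝ} (hu : 0 < u) :
    CoPoisson.inv α u = α u⁻¹ / (u : ℂ) := by
  rw [CoPoisson.inv, abs_of_pos hu]

/-- `∫₀^∞ (Ig)(u) du/u = ∫₀^∞ g` (substitution `u ↦ 1/u`). [folklore] -/
private theorem integral_Ioi_inv_div' (α : ℝ → ℂ) :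
    ∫ u in Ioi (0 : ℝ), CoPoisson.inv α u / (u : ℂ) = ∫ v in Ioi (0 : ℝ), α v := by
  have h := integral_comp_rpow_Ioi (fun v : ℝ ↦ α v) (p := -1) (by norm_num)
  rw [← h]
  refine setIntegral_congr_fun measurableSet_Ioi fun x hx ↦ ?_
  have hx0 : (0 : ℝ) < x := hx
  simp only [Real.rpow_neg_one, inv_apply_of_pos' α hx0]
  have hx2 : x ^ ((-1 : ℝ) - 1) = (x ^ 2)⁻¹ := by
    rw [show ((-1 : ℝ) - 1) = -2 by norm_num, Real.rpow_neg hx0.le, Real.rpow_two]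
  rw [hx2, abs_neg, abs_one, one_mul, Complex.real_smul]
  have hxC : (x : ℂ) ≠ 0 := by exact_mod_cast hx0.ne'
  push_cast
  field_simp

/-- `∫₀^∞ |Ig| < ∞ ⟸ ∫₀^∞ |g| du/u < ∞` (substitution `u ↦ 1/u`). [folklore] -/
private theorem integrableOn_inv_Ioi' {g : ℝ → ℂ}
    (hg1 : IntegrableOn (fun u : ℝ ↦ g u / (u : ℂ)) (Ioi 0)) :
    IntegrableOn (CoPoisson.inv g) (Ioi 0) := by
  have h := (integrableOn_Ioi_comp_rpow_iff' (fun v : ℝ ↦ g v / (v : ℂ)) (p := -1)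
    (by norm_num)).2 hg1
  refine h.congr_fun (fun x hx ↦ ?_) measurableSet_Ioi
  have hx0 : (0 : ℝ) < x := hx
  have hx2 : x ^ ((-1 : ℝ) - 1) = (x ^ 2)⁻¹ := by
    rw [show ((-1 : ℝ) - 1) = -2 by norm_num, Real.rpow_neg hx0.le, Real.rpow_two]
  simp only [Real.rpow_neg_one, hx2, Complex.real_smul, inv_apply_of_pos' g hx0]
  have hxC : (x : ℂ) ≠ 0 := by exact_mod_cast hx0.ne'
  push_cast
  field_simp

/-- **The `L²` co-Poisson intertwining, pointwise a.e.** For a measurable even `g` with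
`∫₀^∞|g|dt/t + ∫₀^∞|g| < ∞` and `F ∈ L²` with `F = P'(g)` a.e., the `L²` Fourier transform of `F`
is a.e. the dual co-Poisson sum `Σ g(n/t)/|t| − ∫₀^∞ g` ([Burnol2004, Thm 4.2] as tempered
distributions + the agreement of the `L²` and distributional transforms; the dual sum is locally
integrable by Thm 4.2's second clause against bump functions). [cite: Burnol2004, Thm 4.2 (TeX l. 1235); Burnol2004b, §2 (TeX l.404–411)] -/
theorem fourier_ae_eq_coSumDual {ge : ℝ → ℂ} (hgem : Measurable ge) (hgee : ∀ u, ge (-u) = ge u)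
    (hβ1 : IntegrableOn (fun u : ℝ ↦ ge u / (u : ℂ)) (Ioi 0)) (hβ2 : IntegrableOn ge (Ioi 0))
    {F : Lp ℂ 2 (volume : Measure ℝ)} (hFae : (F : ℝ → ℂ) =ᵐ[volume] coSum ge) :
    (((𝓕 F : Lp ℂ 2 (volume : Measure ℝ)) : ℝ → ℂ)) =ᵐ[volume] coSumDual ge := by
  have h42 := Burnol2004_thm_4_2_holds ge hgem hgee hβ1 hβ2
  set G : ℝ → ℂ := coSumDual ge with hG
  have hGloc : LocallyIntegrable G := by
    rw [locallyIntegrable_iff]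
    intro k hk
    obtain ⟨R, hR⟩ := hk.isBounded.subset_closedBall 0
    obtain ⟨ψ, hψ⟩ := exists_schwartz_eq_one (|R| + 1) (by positivity)
    have hint := (h42 ψ).2.1
    refine (hint.integrableOn (s := k)).congr_fun (fun t ht ↦ ?_) hk.measurableSet
    have h1 := hR ht
    rw [Metric.mem_closedBall, dist_zero_right, Real.norm_eq_abs] at h1
    show G t * ψ t = G t
    rw [hψ t (by linarith [le_abs_self R]), mul_one]
  have hFT : LocallyIntegrable (((𝓕 F : Lp ℂ 2 (volume : Measure ℝ)) : ℝ → ℂ)) :=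
    (Lp.memLp (𝓕 F)).locallyIntegrable one_le_two
  have hFourier : (((𝓕 F : Lp ℂ 2 (volume : Measure ℝ)) : ℝ → ℂ)) =ᵐ[volume] G := by
    refine ae_eq_of_integral_contDiff_smul_eq hFT hGloc fun g₀ hg₀ hg₀s ↦ ?_
    set fc : ℝ → ℂ := fun x ↦ ((g₀ x : ℝ) : ℂ) with hfc
    have hfc_smooth : ContDiff ℝ ((⊤ : ℕ∞) : WithTop ℕ∞) fc := (Complex.ofRealCLM.contDiff).comp hg₀
    have hfc_supp : HasCompactSupport fc := hg₀s.comp_left Complex.ofReal_zero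
    set ψ : 𝓢(ℝ, ℂ) := hfc_supp.toSchwartzMap hfc_smooth with hψ
    have hψapply : ∀ x : ℝ, ψ x = fc x := fun x ↦ rfl
    have hFψ : ∀ y : ℝ, (𝓕 ψ : 𝓢(ℝ, ℂ)) y = 𝓕 (ψ : ℝ → ℂ) y :=
      fun y ↦ congrFun (SchwartzMap.fourier_coe ψ) y
    calc ∫ x : ℝ, g₀ x • ((𝓕 F : Lp ℂ 2 (volume : Measure ℝ)) : ℝ → ℂ) x
        = ∫ x : ℝ, ψ x • ((𝓕 F : Lp ℂ 2 (volume : Measure ℝ)) : ℝ → ℂ) x := by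
          simp only [hψapply, hfc, Complex.real_smul, smul_eq_mul]
      _ = (MeasureTheory.Lp.toTemperedDistribution (𝓕 F : Lp ℂ 2 (volume : Measure ℝ))) ψ :=
          (Lp.toTemperedDistribution_apply _ ψ).symm
      _ = (𝓕 (MeasureTheory.Lp.toTemperedDistribution F)) ψ := by
          rw [Lp.fourier_toTemperedDistribution_eq]
      _ = (MeasureTheory.Lp.toTemperedDistribution F) (𝓕 ψ) := TemperedDistribution.fourier_apply _ _
      _ = ∫ x : ℝ, (𝓕 ψ : 𝓢(ℝ, ℂ)) x • (F : ℝ → ℂ) x := Lp.toTemperedDistribution_apply _ _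
      _ = ∫ x : ℝ, coSum ge x * 𝓕 (ψ : ℝ → ℂ) x := by
          refine integral_congr_ae ?_
          filter_upwards [hFae] with x hx
          rw [hx, hFψ, smul_eq_mul, mul_comm]
      _ = ∫ t : ℝ, G t * ψ t := (h42 ψ).2.2
      _ = ∫ x : ℝ, g₀ x • G x := by
          congr 1; funext x; rw [hψapply, hfc, Complex.real_smul, mul_comm]
  exact hFourier

/-- Measurable even modification of a co-Poisson datum: for `g ∈ L¹(a, 1/a)` vanishing off `(a,1/a)`
and `F = Σ g(|t|/n)/n − ∫₀^∞ g/u` a.e., there is a measurable even `gₑ`, vanishing for `|u| ≤ a` and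
for `|u| ≥ 1/a`, equal to `g` a.e. on `(0,∞)`, integrable together with `gₑ(u)/u` on `(0,∞)`, with
`F = P'(gₑ)` a.e. [folklore] -/
private theorem exists_even_datum {a : ℝ} (ha : 0 < a) {F : Lp ℂ 2 (volume : Measure ℝ)}
    {g : ℝ → ℂ} (hgi : IntegrableOn g (Ioo a a⁻¹)) (hgz : ∀ t, t ∉ Ioo a a⁻¹ → g t = 0)
    (hF : ∀ᵐ t : ℝ, F t = coPoissonSum g t) :
    ∃ ge : ℝ → ℂ, Measurable ge ∧ (∀ u, ge (-u) = ge u) ∧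
      IntegrableOn (fun u : ℝ ↦ ge u / (u : ℂ)) (Ioi 0) ∧ IntegrableOn ge (Ioi 0) ∧
      (∀ u, |u| ≤ a → ge u = 0) ∧ (∀ u, a⁻¹ ≤ |u| → ge u = 0) ∧
      (∀ᵐ u ∂(volume.restrict (Ioi (0 : ℝ))), ge u = g u) ∧
      ((F : ℝ → ℂ) =ᵐ[volume] coSum ge) := by
  -- Step 0: a measurable modification of the datum, still vanishing off `(a, 1/a)`
  have hgint : Integrable g := hgi.integrable_of_forall_notMem_eq_zero hgz
  set g₁ : ℝ → ℂ := hgint.1.mk g with hg₁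
  have hg₁m : Measurable g₁ := hgint.1.stronglyMeasurable_mk.measurable
  have hgg₁ : g =ᵐ[volume] g₁ := hgint.1.ae_eq_mk
  set g₂ : ℝ → ℂ := (Ioo a a⁻¹).indicator g₁ with hg₂
  have hg₂m : Measurable g₂ := hg₁m.indicator measurableSet_Ioo
  have hg₂z : ∀ t, t ∉ Ioo a a⁻¹ → g₂ t = 0 := fun t ht ↦ Set.indicator_of_notMem ht _
  have hgg₂ : g₂ =ᵐ[volume] g := by
    filter_upwards [hgg₁] with t ht
    by_cases hmem : t ∈ Ioo a a⁻¹
    · rw [hg₂, Set.indicator_of_mem hmem, ht]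
    · rw [hg₂, Set.indicator_of_notMem hmem, hgz t hmem]
  have hg₂int : Integrable g₂ := hgint.congr hgg₂.symm
  -- the even datum `gₑ(u) = g₂(|u|)`
  set ge : ℝ → ℂ := fun u ↦ g₂ |u| with hge
  have hgem : Measurable ge := hg₂m.comp continuous_abs.measurable
  have hgee : ∀ u, ge (-u) = ge u := fun u ↦ by simp [hge]
  have hge_pos : ∀ u, 0 < u → ge u = g₂ u := fun u hu ↦ by simp [hge, abs_of_pos hu]
  have hge_zero : ∀ u, |u| ≤ a → ge u = 0 := fun u hu ↦ hg₂z _ (fun h ↦ by linarith [h.1])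
  have hge_zero' : ∀ u, a⁻¹ ≤ |u| → ge u = 0 := fun u hu ↦ hg₂z _ (fun h ↦ by linarith [h.2])
  have hβ2 : IntegrableOn ge (Ioi 0) :=
    hg₂int.integrableOn.congr_fun (fun u hu ↦ (hge_pos u hu).symm) measurableSet_Ioi
  have hβ1 : IntegrableOn (fun u : ℝ ↦ ge u / (u : ℂ)) (Ioi 0) := by
    refine (hβ2.norm.mul_const a⁻¹).mono'
      ((hgem.mul (Complex.measurable_ofReal.inv)).aestronglyMeasurable) ?_
    refine ae_restrict_of_ae (Eventually.of_forall fun u ↦ ?_)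
    by_cases hu : |u| ≤ a
    · simp [hge_zero u hu]
    · rw [not_le] at hu
      rw [norm_div, Complex.norm_real, Real.norm_eq_abs, div_eq_mul_inv]
      exact mul_le_mul_of_nonneg_left (inv_anti₀ ha hu.le) (norm_nonneg _)
  -- Step 1: `F = P'(gₑ)` almost everywhere
  have hterms : ∀ᵐ t : ℝ, ∀ n : ℕ, g₂ (|t| / ((n : ℝ) + 1)) = g (|t| / ((n : ℝ) + 1)) := by
    rw [ae_all_iff]
    intro n
    have hn1 : (0 : ℝ) < (n : ℝ) + 1 := by positivity
    have hp0 := (quasiMeasurePreserving_mul_right (inv_ne_zero hn1.ne')).ae hgg₂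
    have hm0 := (quasiMeasurePreserving_mul_right (neg_ne_zero.2 (inv_ne_zero hn1.ne'))).ae hgg₂
    filter_upwards [hp0, hm0] with t ht ht'
    rcases le_or_gt 0 t with h0 | h0
    · rw [abs_of_nonneg h0, div_eq_mul_inv]; exact ht
    · rw [abs_of_neg h0, show -t / ((n : ℝ) + 1) = t * -((n : ℝ) + 1)⁻¹ by ring]; exact ht'
  have hconst : ∫ u in Ioi (0 : ℝ), ge u / (u : ℂ) = ∫ u in Ioi (0 : ℝ), g u / (u : ℂ) := by
    rw [setIntegral_congr_fun measurableSet_Ioi (fun u hu ↦ by rw [hge_pos u hu])]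
    exact integral_congr_ae (ae_restrict_of_ae (by filter_upwards [hgg₂] with u hu; rw [hu]))
  have hFae : (F : ℝ → ℂ) =ᵐ[volume] coSum ge := by
    filter_upwards [hF, hterms] with t ht hn
    rw [ht, coPoissonSum, coSum, hconst]
    congr 1
    refine tsum_congr fun n ↦ ?_
    have hn1 : (0 : ℝ) < (n : ℝ) + 1 := by positivity
    rw [hge]; dsimp only
    rw [abs_div, abs_of_pos hn1, hn n]
  have hrestr : ∀ᵐ u ∂(volume.restrict (Ioi (0 : ℝ))), ge u = g u := by
    filter_upwards [ae_restrict_mem measurableSet_Ioi, ae_restrict_of_ae hgg₂] with u hu hu'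
    rw [hge_pos u hu, hu']
  exact ⟨ge, hgem, hgee, hβ1, hβ2, hge_zero, hge_zero', hrestr, hFae⟩

/-- **An `L²` co-Poisson sum and its Fourier transform near the origin** ([Burnol2004b, §2],
TeX l.404–411: for `g ∈ L¹(a, A)`, `A = 1/a`, "its co-Poisson sum `F` is constant (`= −ĝ(1)`) on
`(0,a)`" and "the cosine transform of `F` … is constant on `(0, 1/A)`", the constant being
`−∫₀^∞ g`): for `F ∈ L²` with `F = Σ_n g(|t|/n)/n − ∫₀^∞ g(u)du/u` a.e., `F` is even,
`F = −∫₀^∞ g(u)du/u` a.e. on `(0,a)` and `𝓕F = −∫₀^∞ g` a.e. on `(0,a)`. PROVED from the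
co-Poisson intertwining [Burnol2004, Thm 4.2] (`Burnol2004_thm_4_2_holds`) and the agreement of the
`L²` and distributional Fourier transforms. [cite: Burnol2004b, §2 (arXiv:math/0203120v7 p. 5, TeX l.404–411)] -/
theorem coPoissonSum_ae_eq_const {a : ℝ} (ha : 0 < a) {F : Lp ℂ 2 (volume : Measure ℝ)}
    {g : ℝ → ℂ} (hgi : IntegrableOn g (Ioo a a⁻¹)) (hgz : ∀ t, t ∉ Ioo a a⁻¹ → g t = 0)
    (hF : ∀ᵐ t : ℝ, F t = coPoissonSum g t) :
    F ∈ evenL2 ∧ (∀ᵐ x : ℝ, x ∈ Ioo 0 a → F x = -∫ u in Ioi (0 : ℝ), g u / (u : ℂ)) ∧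
      (∀ᵐ x : ℝ, x ∈ Ioo 0 a →
        (𝓕 F : Lp ℂ 2 (volume : Measure ℝ)) x = -∫ u in Ioi (0 : ℝ), g u) := by
  obtain ⟨ge, hgem, hgee, hβ1, hβ2, hge_zero, hge_zero', hrestr, hFae⟩ :=
    exists_even_datum ha hgi hgz hF
  have hconst : ∫ u in Ioi (0 : ℝ), ge u / (u : ℂ) = ∫ u in Ioi (0 : ℝ), g u / (u : ℂ) :=
    integral_congr_ae (by filter_upwards [hrestr] with u hu; rw [hu])
  -- Step 2: values on `(0, a)`
  have hzero : ∀ x : ℝ, 0 < x → x < a →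
      coSum ge x = -∫ u in Ioi (0 : ℝ), g u / (u : ℂ) := by
    intro x hx0 hxa
    rw [coSum, hconst]
    have : ∀ n : ℕ, ge (x / ((n : ℝ) + 1)) / ((n : ℂ) + 1) = 0 := by
      intro n
      have hn1 : (1 : ℝ) ≤ (n : ℝ) + 1 := by linarith [show (0 : ℝ) ≤ n from Nat.cast_nonneg n]
      have : |x / ((n : ℝ) + 1)| ≤ a := by
        rw [abs_div, abs_of_pos hx0, abs_of_pos (by linarith)]
        exact (div_le_self hx0.le hn1).trans hxa.le
      simp [hge_zero _ this]
    rw [tsum_congr this, tsum_zero, zero_sub]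
  have hzero' : ∀ x : ℝ, 0 < x → x < a →
      coSumDual ge x = -∫ u in Ioi (0 : ℝ), ge u := by
    intro x hx0 hxa
    rw [coSumDual]
    have : ∀ n : ℕ, ge (((n : ℝ) + 1) / x) = 0 := by
      intro n
      apply hge_zero'
      rw [abs_div, abs_of_pos hx0, abs_of_pos (by positivity), le_div_iff₀ hx0]
      calc a⁻¹ * x ≤ a⁻¹ * a := by gcongr
        _ = 1 := inv_mul_cancel₀ ha.ne'
        _ ≤ (n : ℝ) + 1 := by linarith [show (0 : ℝ) ≤ n from Nat.cast_nonneg n]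
    rw [tsum_congr this, tsum_zero, zero_div, zero_sub]
  -- Step 3: `𝓕F` is a.e. the dual sum
  have hFourier := fourier_ae_eq_coSumDual hgem hgee hβ1 hβ2 hFae
  -- Step 4: assemble
  have hconst' : ∫ u in Ioi (0 : ℝ), ge u = ∫ u in Ioi (0 : ℝ), g u :=
    integral_congr_ae (by filter_upwards [hrestr] with u hu; rw [hu])
  refine ⟨?_, ?_, ?_⟩
  · have hFae' : ∀ᵐ x : ℝ, (F : ℝ → ℂ) (-x) = coSum ge (-x) :=
      (Measure.measurePreserving_neg (volume : Measure ℝ)).quasiMeasurePreserving.ae hFae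
    filter_upwards [hFae, hFae'] with x hx hx'
    rw [hx', hx, coSum_neg hgee]
  · filter_upwards [hFae] with x hx hxa
    rw [hx]
    exact hzero x hxa.1 hxa.2
  · filter_upwards [hFourier] with x hx hxa
    rw [hx, ← hconst']
    exact hzero' x hxa.1 hxa.2

/-- **`P_a ⊆ L_a`** ([Burnol2004b, §2]: "`P_a ⊂ L_a`"; the tree's `coPoissonP` deliberately does
not build this in — "that inclusion is a theorem, not built into this definition"). PROVED.
[cite: Burnol2004b, §2 (arXiv:math/0203120v7 p. 5, TeX l.404–411, 493–498)] -/
theorem coPoissonP_subset_sonineL {a : ℝ} (ha : 0 < a) : coPoissonP a ⊆ sonineL a := by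
  rintro F ⟨g, hgi, hgz, hF⟩
  obtain ⟨h1, h2, h3⟩ := coPoissonSum_ae_eq_const ha hgi hgz hF
  exact ⟨h1, ⟨_, h2⟩, ⟨_, h3⟩⟩

/-- **Co-Poisson sums with two vanishing moments are Sonine functions** (`L¹` data): if moreover
`∫₀^∞ g(u)du/u = 0 = ∫₀^∞ g` then the `L²` co-Poisson sum lies in `K_a` ([Burnol2004, §6 opening,
TeX l.2190–2203], here for `g ∈ L¹(a, 1/a)` via Thm 4.2 instead of smooth `α` via Thm 4.4).
[cite: Burnol2004, §6 (TeX l.2190–2203); Burnol2004b, §2 (TeX l.404–411)] -/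
theorem mem_sonineK_of_coPoissonSum {a : ℝ} (ha : 0 < a) {F : Lp ℂ 2 (volume : Measure ℝ)}
    {g : ℝ → ℂ} (hgi : IntegrableOn g (Ioo a a⁻¹)) (hgz : ∀ t, t ∉ Ioo a a⁻¹ → g t = 0)
    (hF : ∀ᵐ t : ℝ, F t = coPoissonSum g t)
    (h1 : ∫ u in Ioi (0 : ℝ), g u / (u : ℂ) = 0) (h0 : ∫ u in Ioi (0 : ℝ), g u = 0) :
    F ∈ sonineK a := by
  obtain ⟨he, h2, h3⟩ := coPoissonSum_ae_eq_const ha hgi hgz hF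
  refine ⟨he, ?_, ?_⟩
  · filter_upwards [h2] with x hx hxa
    rw [hx hxa, h1, neg_zero]
  · filter_upwards [h3] with x hx hxa
    rw [hx hxa, h0, neg_zero]

/-- **`P_a` is stable under the cosine transform**: the `L²` Fourier transform of an `L²` co-Poisson
sum of `g ∈ L¹(a, 1/a)` is the `L²` co-Poisson sum of `(Ig)(t) = g(1/t)/t ∈ L¹(a, 1/a)`
(`𝓕₊ P' = P' I` on such data: [Burnol2004, Thm 4.2] "`𝓕(P'(g)) = P'(I(g))`", in `L²` by
`fourier_ae_eq_coSumDual`). [cite: Burnol2004, Thm 4.2 (TeX l. 1235); Burnol2004b, §2 (TeX l.404–411, 493–498)] -/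
theorem fourier_mem_coPoissonP {a : ℝ} (ha : 0 < a) {F : Lp ℂ 2 (volume : Measure ℝ)}
    (hF : F ∈ coPoissonP a) : (𝓕 F : Lp ℂ 2 (volume : Measure ℝ)) ∈ coPoissonP a := by
  obtain ⟨g, hgi, hgz, hFg⟩ := hF
  obtain ⟨ge, hgem, hgee, hβ1, hβ2, hge_zero, hge_zero', -, hFae⟩ :=
    exists_even_datum ha hgi hgz hFg
  have hFourier := fourier_ae_eq_coSumDual hgem hgee hβ1 hβ2 hFae
  -- the new datum `g'(u) = g_e(1/u)/u` on `u > 0`, `0` elsewhere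
  set g' : ℝ → ℂ := fun u ↦ if 0 < u then CoPoisson.inv ge u else 0 with hg'
  have hg'_pos : ∀ u, 0 < u → g' u = ge u⁻¹ / (u : ℂ) := fun u hu ↦ by
    rw [hg']; dsimp only; rw [if_pos hu, inv_apply_of_pos' ge hu]
  have hg'_eqOn : EqOn g' (CoPoisson.inv ge) (Ioi 0) := fun u hu ↦ by
    rw [hg'_pos u hu, inv_apply_of_pos' ge hu]
  refine ⟨g', ?_, ?_, ?_⟩
  · -- integrability on `(a, 1/a)`
    exact ((integrableOn_inv_Ioi' hβ1).congr_fun hg'_eqOn.symm measurableSet_Ioi).mono_set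
      (fun u hu ↦ ha.trans hu.1)
  · -- vanishing off `(a, 1/a)`
    intro t ht
    by_cases ht0 : 0 < t
    · rw [hg'_pos t ht0]
      have hz : ge t⁻¹ = 0 := by
        by_cases hta : t ≤ a
        · exact hge_zero' _ (by rw [abs_of_pos (inv_pos.2 ht0)]; exact inv_anti₀ ht0 hta)
        · have hta' : a⁻¹ ≤ t := by
            by_contra h
            exact ht ⟨lt_of_not_ge hta, lt_of_not_ge h⟩
          refine hge_zero _ ?_
          rw [abs_of_pos (inv_pos.2 ht0)]
          calc t⁻¹ ≤ (a⁻¹)⁻¹ := inv_anti₀ (inv_pos.2 ha) hta'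
            _ = a := inv_inv a
      rw [hz, zero_div]
    · rw [hg']; dsimp only; rw [if_neg ht0]
  · -- `𝓕F = Σ g'(|t|/n)/n − ∫₀^∞ g'(u)du/u` a.e.
    have h0 : ∀ᵐ t : ℝ, t ≠ 0 := by
      rw [ae_iff]
      simp
    have hint : ∫ u in Ioi (0 : ℝ), g' u / (u : ℂ) = ∫ u in Ioi (0 : ℝ), ge u := by
      rw [setIntegral_congr_fun measurableSet_Ioi (fun u hu ↦ by rw [hg'_eqOn hu])]
      exact integral_Ioi_inv_div' ge
    filter_upwards [hFourier, h0] with t ht ht0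
    rw [ht, coSumDual, coPoissonSum, hint, ← tsum_div_const]
    congr 1
    refine tsum_congr fun n ↦ ?_
    have hn1 : (0 : ℝ) < (n : ℝ) + 1 := by positivity
    have htpos : 0 < |t| := abs_pos.2 ht0
    have harg : 0 < |t| / ((n : ℝ) + 1) := div_pos htpos hn1
    rw [hg'_pos _ harg, inv_div]
    -- `gₑ((n+1)/|t|) = gₑ((n+1)/t)` by evenness
    have heven : ge (((n : ℝ) + 1) / |t|) = ge (((n : ℝ) + 1) / t) := by
      rcases lt_or_gt_of_ne ht0 with hneg | hpos
      · rw [abs_of_neg hneg, div_neg, hgee]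
      · rw [abs_of_pos hpos]
    rw [heven]
    have h1 : (((n : ℝ) + 1 : ℝ) : ℂ) ≠ 0 := by exact_mod_cast hn1.ne'
    have h2 : ((|t| : ℝ) : ℂ) ≠ 0 := by exact_mod_cast htpos.ne'
    push_cast
    field_simp

/-! ### Glue between the two co-Poisson vocabularies -/

/-- For an EVEN datum the co-Poisson sum `P'(g)` of `BurnolFourierZeta.lean` (`CoPoisson.coSum g`,
terms `g(t/n)/n`) and the co-Poisson sum of `BurnolZetaSystems.lean` (`coPoissonSum g`, terms
`g(|t|/n)/n`, Burnol's even extension) coincide. [cite: Burnol2004b, §2 (arXiv:math/0203120v7 p. 5, TeX l.395–399); Burnol2004, Thm 4.2 (TeX l. 1235)] -/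
theorem coSum_eq_coPoissonSum_of_even {g : ℝ → ℂ} (hge : ∀ u, g (-u) = g u) (t : ℝ) :
    coSum g t = coPoissonSum g t := by
  rw [coSum, coPoissonSum]
  congr 1
  refine tsum_congr fun n ↦ ?_
  rcases le_or_gt 0 t with h0 | h0
  · rw [abs_of_nonneg h0]
  · rw [abs_of_neg h0, neg_div, hge]

/-- **Smooth co-Poisson sums lie in `P_a`**: for `α` smooth, even, compactly supported away from `0`
and vanishing off `(a, 1/a) ∪ (−1/a, −a)`, the `L²` class of `P'(α)` belongs to the co-Poisson subspace
`P_a` (the examples of [Burnol2004, §6 opening, TeX l.2190–2203], placed in the `P_a` of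
[Burnol2004b, §2]). [cite: Burnol2004b, §2 (arXiv:math/0203120v7 p. 5, TeX l.493–498); Burnol2004, Thm 3.9 (TeX l. 1137)] -/
theorem CoPoisson.IsTestAway.toLp_coSum_mem_coPoissonP {a : ℝ} {α : ℝ → ℂ} (hα : IsTestAway α)
    (hαz : ∀ t, 0 < t → t ∉ Ioo a a⁻¹ → α t = 0) :
    (hα.memLp_two_coSum.toLp (coSum α) : Lp ℂ 2 (volume : Measure ℝ)) ∈ coPoissonP a := by
  set g : ℝ → ℂ := (Ioi (0 : ℝ)).indicator α with hg
  have hg_pos : ∀ u, 0 < u → g u = α u := fun u hu ↦ by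
    rw [hg, Set.indicator_of_mem (show u ∈ Ioi (0 : ℝ) from hu)]
  have hg_nonpos : ∀ u, u ≤ 0 → g u = 0 := fun u hu ↦ by
    rw [hg, Set.indicator_of_notMem (show u ∉ Ioi (0 : ℝ) from not_lt.2 hu)]
  refine ⟨g, ?_, ?_, ?_⟩
  · -- `α` is continuous with compact support, hence integrable; so is its restriction
    have hint : Integrable α :=
      hα.contDiff.continuous.integrable_of_hasCompactSupport hα.hasCompactSupport
    exact ((hint.indicator measurableSet_Ioi).integrableOn : IntegrableOn g (Ioo a a⁻¹))
  · intro t ht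
    by_cases ht0 : 0 < t
    · rw [hg_pos t ht0]; exact hαz t ht0 ht
    · exact hg_nonpos t (not_lt.1 ht0)
  · have h0 : ∀ᵐ t : ℝ, t ≠ 0 := by
      rw [ae_iff]
      simp
    filter_upwards [hα.memLp_two_coSum.coeFn_toLp, h0] with t ht ht0
    rw [ht, coSum_eq_coPoissonSum_of_even hα.even, coPoissonSum, coPoissonSum]
    have htpos : 0 < |t| := abs_pos.2 ht0
    congr 1
    · refine tsum_congr fun n ↦ ?_
      rw [hg_pos _ (div_pos htpos (by positivity))]
    · exact setIntegral_congr_fun measurableSet_Ioi fun u hu ↦ by rw [hg_pos u hu]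

/-- `coPoissonSum` is homogeneous in the datum. [cite: Burnol2004b, §2 (arXiv:math/0203120v7 p. 5, TeX l.395–399)] -/
theorem coPoissonSum_const_mul (c : ℂ) (g : ℝ → ℂ) (t : ℝ) :
    coPoissonSum (fun u ↦ c * g u) t = c * coPoissonSum g t := by
  rw [coPoissonSum, coPoissonSum, mul_sub, ← tsum_mul_left, ← integral_const_mul]
  congr 1
  · exact tsum_congr fun n ↦ by ring
  · exact setIntegral_congr_fun measurableSet_Ioi fun u _ ↦ by ring

/-- `0 ∈ P_a`. [cite: Burnol2004b, §2 (arXiv:math/0203120v7 p. 5, TeX l.493–498), "the subspace"] -/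
theorem zero_mem_coPoissonP (a : ℝ) : (0 : Lp ℂ 2 (volume : Measure ℝ)) ∈ coPoissonP a := by
  refine ⟨0, integrableOn_zero, fun _ _ ↦ rfl, ?_⟩
  filter_upwards [Lp.coeFn_zero ℂ 2 (volume : Measure ℝ)] with t ht
  rw [ht, Pi.zero_apply, coPoissonSum]
  simp

/-- `P_a` is stable under scalars: `c • P'(g) = P'(c g)`. [cite: Burnol2004b, §2 (arXiv:math/0203120v7 p. 5, TeX l.493–498), "the subspace"] -/
theorem smul_mem_coPoissonP {a : ℝ} (c : ℂ) {F : Lp ℂ 2 (volume : Measure ℝ)}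
    (hF : F ∈ coPoissonP a) : c • F ∈ coPoissonP a := by
  obtain ⟨g, hgi, hgz, hFg⟩ := hF
  refine ⟨fun u ↦ c * g u, hgi.const_mul c, fun t ht ↦ by simp only [hgz t ht, mul_zero], ?_⟩
  filter_upwards [Lp.coeFn_smul c F, hFg] with t ht ht'
  rw [ht, Pi.smul_apply, ht', smul_eq_mul, coPoissonSum_const_mul]

/-- For a datum supported in `(a, 1/a)` the co-Poisson series at `t` has only finitely many non-zero
terms (`n < |t|/a`), hence is summable. [cite: Burnol2004b, §2 (arXiv:math/0203120v7 p. 5, TeX l.404–406), "its co-Poisson sum"] -/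
theorem summable_coPoisson_terms {a : ℝ} (ha : 0 < a) {g : ℝ → ℂ}
    (hgz : ∀ t, t ∉ Ioo a a⁻¹ → g t = 0) (t : ℝ) :
    Summable fun n : ℕ ↦ g (|t| / ((n : ℝ) + 1)) / ((n : ℂ) + 1) := by
  obtain ⟨N, hN⟩ := exists_nat_gt (|t| / a)
  refine summable_of_ne_finset_zero (s := Finset.range N) fun n hn ↦ ?_
  rw [Finset.mem_range, not_lt] at hn
  have hn1 : (0 : ℝ) < (n : ℝ) + 1 := by positivity
  have hle : |t| / ((n : ℝ) + 1) ≤ a := by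
    rw [div_le_iff₀ hn1]
    have h1 : |t| < a * N := by rwa [div_lt_iff₀ ha, mul_comm] at hN
    have h2 : (N : ℝ) ≤ (n : ℝ) + 1 := by exact_mod_cast Nat.le_succ_of_le hn
    nlinarith
  rw [hgz _ (fun h ↦ absurd h.1 (not_lt.2 hle)), zero_div]

/-- For a datum `g ∈ L¹(a, 1/a)` vanishing off `(a, 1/a)`, `g(u)/u` is integrable on `(0,∞)`
(`1/u < 1/a` on the support). [cite: Burnol2004b, §2 (arXiv:math/0203120v7 p. 5, TeX l.404–406)] -/
theorem integrableOn_div_of_coPoisson_datum {a : ℝ} (ha : 0 < a) {g : ℝ → ℂ}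
    (hgi : IntegrableOn g (Ioo a a⁻¹)) (hgz : ∀ t, t ∉ Ioo a a⁻¹ → g t = 0) :
    IntegrableOn (fun u : ℝ ↦ g u / (u : ℂ)) (Ioi 0) := by
  have hgint : Integrable g := hgi.integrable_of_forall_notMem_eq_zero hgz
  refine ((hgint.norm.mul_const a⁻¹).mono'
    (hgint.1.mul (Complex.continuous_ofReal.measurable.inv.aestronglyMeasurable)) ?_).integrableOn
  refine Eventually.of_forall fun u ↦ ?_
  show ‖g u * ((u : ℂ))⁻¹‖ ≤ ‖g u‖ * a⁻¹
  by_cases hu : u ∈ Ioo a a⁻¹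
  · rw [norm_mul, norm_inv, Complex.norm_real, Real.norm_eq_abs, abs_of_pos (ha.trans hu.1)]
    exact mul_le_mul_of_nonneg_left (inv_anti₀ ha hu.1.le) (norm_nonneg _)
  · simp [hgz u hu]

/-- `coPoissonSum` is additive in the datum, for data supported in `(a, 1/a)` and integrable there.
[cite: Burnol2004b, §2 (arXiv:math/0203120v7 p. 5, TeX l.493–498), "the subspace"] -/
theorem coPoissonSum_add {a : ℝ} (ha : 0 < a) {g₁ g₂ : ℝ → ℂ}
    (h₁i : IntegrableOn g₁ (Ioo a a⁻¹)) (h₁z : ∀ t, t ∉ Ioo a a⁻¹ → g₁ t = 0)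
    (h₂i : IntegrableOn g₂ (Ioo a a⁻¹)) (h₂z : ∀ t, t ∉ Ioo a a⁻¹ → g₂ t = 0) (t : ℝ) :
    coPoissonSum (fun u ↦ g₁ u + g₂ u) t = coPoissonSum g₁ t + coPoissonSum g₂ t := by
  rw [coPoissonSum, coPoissonSum, coPoissonSum]
  have hs : ∑' n : ℕ, (g₁ (|t| / ((n : ℝ) + 1)) + g₂ (|t| / ((n : ℝ) + 1))) / ((n : ℂ) + 1) =
      (∑' n : ℕ, g₁ (|t| / ((n : ℝ) + 1)) / ((n : ℂ) + 1)) +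
        ∑' n : ℕ, g₂ (|t| / ((n : ℝ) + 1)) / ((n : ℂ) + 1) := by
    rw [← (summable_coPoisson_terms ha h₁z t).tsum_add (summable_coPoisson_terms ha h₂z t)]
    exact tsum_congr fun n ↦ by ring
  have hi : ∫ u in Ioi (0 : ℝ), (g₁ u + g₂ u) / (u : ℂ) =
      (∫ u in Ioi (0 : ℝ), g₁ u / (u : ℂ)) + ∫ u in Ioi (0 : ℝ), g₂ u / (u : ℂ) := by
    rw [← integral_add (integrableOn_div_of_coPoisson_datum ha h₁i h₁z)
      (integrableOn_div_of_coPoisson_datum ha h₂i h₂z)]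
    exact setIntegral_congr_fun measurableSet_Ioi fun u _ ↦ by ring
  rw [hs, hi]
  ring

/-- **`P_a` is stable under addition**: `P'(g₁) + P'(g₂) = P'(g₁ + g₂)`. With `zero_mem_coPoissonP`
and `smul_mem_coPoissonP`: `P_a` is a linear subspace of `L²` ("the co-Poisson subspace").
[cite: Burnol2004b, §2 (arXiv:math/0203120v7 p. 5, TeX l.493–498)] -/
theorem add_mem_coPoissonP {a : ℝ} (ha : 0 < a) {F₁ F₂ : Lp ℂ 2 (volume : Measure ℝ)}
    (h₁ : F₁ ∈ coPoissonP a) (h₂ : F₂ ∈ coPoissonP a) : F₁ + F₂ ∈ coPoissonP a := by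
  obtain ⟨g₁, h₁i, h₁z, h₁F⟩ := h₁
  obtain ⟨g₂, h₂i, h₂z, h₂F⟩ := h₂
  refine ⟨fun u ↦ g₁ u + g₂ u, h₁i.add h₂i, fun t ht ↦ by simp only [h₁z t ht, h₂z t ht, add_zero],
    ?_⟩
  filter_upwards [Lp.coeFn_add F₁ F₂, h₁F, h₂F] with t ht ht₁ ht₂
  rw [ht, Pi.add_apply, ht₁, ht₂, coPoissonSum_add ha h₁i h₁z h₂i h₂z]

/-- For `a ≥ 1` the interval `(a, 1/a)` is empty and `P_a = {0}` (the co-Poisson subspace matters for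
`a < 1`: "For `a < 1` the perpendicular complement to `Y_a` is the co-Poisson subspace `P_a`",
[Burnol2004b, Thm. 3.1]). [cite: Burnol2004b, §2 and Thm. 3.1 (arXiv:math/0203120v7 pp. 5–6, TeX l.493–498, 516–525)] -/
theorem coPoissonP_eq_singleton_zero_of_one_le {a : ℝ} (ha : 1 ≤ a) :
    coPoissonP a = {(0 : Lp ℂ 2 (volume : Measure ℝ))} := by
  have hempty : Ioo a a⁻¹ = ∅ := Set.Ioo_eq_empty (not_lt.2 ((inv_le_one_of_one_le₀ ha).trans ha))
  refine Set.eq_singleton_iff_unique_mem.2 ⟨zero_mem_coPoissonP a, fun F hF ↦ ?_⟩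
  obtain ⟨g, -, hgz, hFg⟩ := hF
  have hg0 : ∀ t, g t = 0 := fun t ↦ hgz t (by rw [hempty]; exact Set.notMem_empty t)
  refine Lp.eq_zero_iff_ae_eq_zero.2 ?_
  filter_upwards [hFg] with t ht
  rw [ht, coPoissonSum]
  simp [hg0]

/-- The co-Poisson subspaces decrease: `P_a ⊆ P_b` for `0 < b ≤ a` (`(a,1/a) ⊆ (b,1/b)`).
[cite: Burnol2004b, §2 (arXiv:math/0203120v7 p. 5, TeX l.493–498)] -/
theorem coPoissonP_antitone {a b : ℝ} (hb : 0 < b) (hba : b ≤ a) : coPoissonP a ⊆ coPoissonP b := by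
  rintro F ⟨g, hgi, hgz, hFg⟩
  have hsub : Ioo a a⁻¹ ⊆ Ioo b b⁻¹ := Set.Ioo_subset_Ioo hba (inv_anti₀ hb hba)
  have hgz' : ∀ t, t ∉ Ioo b b⁻¹ → g t = 0 := fun t ht ↦ hgz t (fun h ↦ ht (hsub h))
  exact ⟨g, (hgi.integrable_of_forall_notMem_eq_zero hgz).integrableOn, hgz', hFg⟩

end CoPoissonSubspace

end Literature.NumberTheory.LFunctions
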